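import Summits.QuantumFields.BalabanUV.Beta.GAN24.Lin4Additive
import Summits.QuantumFields.BalabanUV.Beta.GAN24.WSlotT2OfPieces
import Summits.QuantumFields.BalabanUV.Beta.SecondOrderRemainderTables
import Summits.QuantumFields.BalabanUV.Beta.TameKernelCalculus
import Summits.QuantumFields.BalabanUV.Gaps.CapTailPinnedLimitSign
import Literature.MathematicalPhysics.QuantumFieldTheory.Balaban1983to89.Beta.ScalewiseWitness

/-!
# `BalabanUV.Gaps.D1PinnedColourResponseUniversal` — cell pub-balaban-gaps, row (D1), seat g1-p1: THE RESPONSE OF THE PINNED FAMILY's ONE-LOOP COEFFICIENTS TO THE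
# FIRST-ORDER COLOUR CONSTANTS `(cE, cVH, cΛ)` IS FREE OF THE ROOT AND OF THE SECOND-ORDER DATA — the colour triple can be SWAPPED between any two members:
# `β⁰_j(r,c⃗;cB,T) + β⁰_j(r′,c⃗′;cB′,T′) = β⁰_j(r,c⃗′;cB,T) + β⁰_j(r′,c⃗;cB′,T′)` at every level, hence for the limit, hypothesis-free; with the sibling files the
# limit SEPARATES ADDITIVELY: `lim β⁰(r,c⃗;cB,Tc) = γ(r) + φ(c⃗) + cB·σ(r) + λ(Tc)`

HONEST FRAMING (cell rule, page 1 of everything): [folklore] kernel algebra and real-sequence bookkeeping BY NAME over tree theorems — an2's recursion `BalabanStepW2.T2Of`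
∕ `WbalOf` ∕ `e4OfW` ∕ `K3OfK` ∕ `T2Of_loc` ∕ `vertexFamily₂_WbalOf'`, the β sub-cell's `SecondOrderResponse.W2SymOfK ∕ W2OfK_apply`, an4's `decays_KInvStep` ∕ `hTA_TbalOf`,
gan24's `T2RecursionAffine.W2SymOfK_eq_add_vsym ∕ K3OfK_eq_sub_of_W ∕ vsym` and `Lin4Additive.vsym_add`, `KernelReflection.comp_smul_left ∕ comp_smul_right`,
`ThirdJetKernel.mmRead_sub`, the β sub-cell's `TameKernelCalculus.tadpole_add`, `ScalewiseWitness.secondMoment_add`, an1's closed form `MixedJetTablesPlug.TbalOf_JsBalAn1`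
(at TWO roots), and g1-p3's hypothesis-free `CapTailPinnedLimitSign.tendsto_pinned ∕ d1Drift_pinned_iff_lim_eq`.  NOTHING of Bałaban's is asserted beyond print;
[Balaban1987RG1] Thm 2 is UNPROVED IN PRINT; which colour constants, root and second-order data are print's is NOT decided here ((P6)); NO value of any coefficient is
computed or signed; (D1) NOT discharged at any literal; 0∕4 row-D1 binders; NOT `BetaPertH`, NOT the continuum limit, NOT Clay.  HONEST DEPENDENCY (b2b cell, verbatim):
«continuum YM on T⁴ ⇐ BetaPertH ∧ nine spine estimates (0/9 proved); BetaPertH ⇐ (D1) ∧ (D4) ∧ CAP+tail; G-an2-4 gates asym, D1 and NE2/3/4.»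

WHY (row (D1); the fifth of this seat's GEN 10 files on the structure of the β-lead's pinned family `JsBalAn1(r; cE cVH cΛ; Lc^8; cB; Tc)`).  In an2's recursion the first-order
colour triple `c⃗ = (cE,cVH,cΛ)` enters member `j+1` of `T2Of` only through an2's first tables `Spure c⃗ j`, `M1 cΛ j` (the `W`-free part of `K3OfK` and the first-order
part of the carrier `W2SymOfK K S M T₂ M₂`), the root `r` only through an1's rooted tables, the data `(cB, Tc)` only through member `0` and the border weight — all ADDITIVELY,
the only coupling between levels being the universal sandwich `T ↦ −K·vsym K T·K` read at the coarse points (§1 `W2SymOfK_firstOrder_swap`; gan24's `K3OfK_eq_sub_of_W`).  Hence the COLOUR SWAP identity propagates by induction (§2), through the assembled family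
(§3), the step kernels of the pinned literal at two roots (§4: the axial dressing is universal, the first-order vertex families travel WITH their colour triple and the two
bubble halves appear once on each side — `hessKer_colourSwap`), the (1.22) coefficients and the limit (§5).  READINGS (§6, hypothesis-free at the pin, `2 ≤ Lc`, any
channel): **`colourResponse_universal`** `lim β⁰(r,c⃗;cB,Tc) − lim β⁰(r,c⃗′;cB,Tc) = lim β⁰(r′,c⃗;cB′,Tc′) − lim β⁰(r′,c⃗′;cB′,Tc′)` — the response of the limit to the
first-order colour constants is ONE function of the two triples, free of the root, the border weight and the position table; **`lim_eq_rootPart_add_colourPart`**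
`lim β⁰(r,c⃗;cB,Tc) = lim β⁰(r,0⃗;cB,Tc) + (lim β⁰(r₀,c⃗;0,0) − lim β⁰(r₀,0⃗;0,0))` for ANY reference root `r₀`; **`d1Drift_JsBalAn1_iff_colourSeparated`**.  TOGETHER with
`Gaps/D1PinnedSecondOrderModular`, `D1PinnedPositionTableAffine` v2, `D1PinnedSecondOrderUniversal`, `D1PinnedTableResponseUniversal` (GEN 10) and `D1PinnedBorderWeightAffine`
(GEN 9, p370181): the limit coefficient of the pinned family SEPARATES ADDITIVELY into FOUR UNIVERSAL PIECES, `lim β⁰(r,c⃗;cB,Tc) = γ(r) + φ(c⃗) + cB·σ(r) + λ(Tc)` —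
`γ, σ` colour-free functions of the root, `φ` a root-free function of the colour triple, `λ` a linear functional of the table, all depending otherwise on `Lc` and the channel
alone (census words; the capstone file waits for oleans).  So (D1) at the β-lead's pinned literal is the equation `γ(r) + φ(c⃗) + cB·σ(r) + λ(Tc) = stepBal N Lc`: print's
first-order constants, its border weight and its position table are probed SEPARATELY; no value is computed here.
CONTENT (all [folklore]; no `def`, no `def … : Prop`, nothing cited as a hypothesis, 0 sorry): §1 **`W2SymOfK_firstOrder_swap`** (pure algebra), `sandwich_neg`,
`W2SymOfK_colourSwap_of_tables`; §2 **`T2Of_colourSwap`**; §3 **`WbalOf_T2Of_colourSwap`**; §4 `hessKer_colourSwap`, **`TbalOf_JsBalAn1_colourSwap`**,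
**`secondMoment_JsBalAn1_colourSwap`** (`d = 3`, two roots); §5 **`lim_JsBalAn1_colourSwap`** (the pin); §6 as above, + **`colourBlind_everywhere_of_somewhere`**.

ABSOLUTE RULE (cell charter, verbatim): «No internally-minted statement may enter as a cited fact. Every hypothesis is either kernel-proved in this
package or a verbatim quotation of a PUBLISHED theorem with page reference. The manuscript(s) under audit are NOT citable for their own disputed
steps — they are the thing under adjudication; programme-internal (2001/route/tribunal) claims are never citable.»

Provenance: cell pub-balaban-gaps, seat g1-p1 GEN 10 (prover-pub-balaban-gaps-g1-p1-g10-0), 2026-08-23; imports gan24's `GAN24.Lin4Additive` ∕ `GAN24.WSlotT2OfPieces`, the β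
sub-cell's `SecondOrderRemainderTables` ∕ `TameKernelCalculus`, g1-p3's `Gaps/CapTailPinnedLimitSign`, and the Literature `Beta.ScalewiseWitness` ONLY (all with farm
oleans); independent of the sibling files; every tree theorem used BY NAME; no existing file touched.
-/

noncomputable section
open Literature.MathematicalPhysics.QuantumFieldTheory Balaban1983to89 Balaban1983to89.Beta Filter Topology
open ExpKernelCalculus (MKer Decays BiLoc VertexFamily₂ comp hessKer tadpole)
open OneStepResolventKernel (Fib decays_mono biLoc_mono)
open OneStepKernelFamily (KInvStep decays_KInvStep TbalOf D1Drift hTA_TbalOf)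
open SecondOrderResponse (W2SymOfK LocStencilFM)
open BalabanCompositeJets (LocStencil₂)
open BalabanStepJetsSucc (mmRead JsBal0Of)
open BalabanStepW2 (Spure M1 M2Of WbalOf T2Of T2Of_zero T2Of_succ T2Of_loc e4OfW K3OfK wV4 wB2 vertexFamily₂_WbalOf' WbalT2Of CwOf δwOf δwOf_pos WbalOf_loc₂)
open Summit.QuantumFields.BalabanUV.Beta.GAN24.ThirdJetKernel (mmRead_sub)
open SecondOrderResponse (W2OfK W2OfK_apply)
open Summit.QuantumFields.BalabanUV.Beta.GAN24.T2RecursionAffine (vsym lin4 lin4_apply W2SymOfK_eq_add_vsym K3OfK_eq_sub_of_W)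
open Summit.QuantumFields.BalabanUV.Beta.GAN24.Lin4Additive (lin4_add vsym_add)
open Summit.QuantumFields.BalabanUV.Beta.GAN24.WSlotT2OfPieces (locStencil₂_zero)
open Summit.QuantumFields.BalabanUV.Beta.SecondOrderRemainderTables (abs_le_of_locStencil₂)
open AffineAveraging (box toSite)
open AveragingMixedJetTables (vh₂SAt mixFFAt)
open RateCertificate (CauchyRate)
open AxialDressing (axDressK axVertexOfK decays_axDressK)
open ScalewiseWitness (secondMoment_add)
open Summit.QuantumFields.BalabanUV.Beta.TameKernelCalculus (Spr Loc tadpole_add)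
open Summit.QuantumFields.BalabanUV.Beta.MixedJetTablesPlug (JsBalAn1 TbalOf_JsBalAn1 hB_an1 hmix_an1)
open Summit.QuantumFields.BalabanUV.Beta.GAN24.StencilSlotOfE3 (one_le_of_two_le)
open Summit.QuantumFields.BalabanUV.Gaps.CapTailPinnedLimitSign (tendsto_pinned d1Drift_pinned_iff_lim_eq)

namespace Summit.QuantumFields.BalabanUV.Gaps.D1PinnedColourResponseUniversal

variable {d : ℕ} {Lc : ℕ} [NeZero Lc]

/-! ## §1 Algebra: the first-order and the second-order slots of the symmetrised carrier do not interact; the sandwich of a negated kernel -/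

/-- [folklore] **THE FIRST-ORDER DATA CAN BE SWAPPED BETWEEN TWO SYMMETRISED CARRIERS** (pure algebra on `SecondOrderResponse.W2OfK_apply`: `W2OfK K N S M S₂ M₂` is the sum of
a part seeing only `(S₂, M₂)` — the bi-vertex and the two mixed vertices — and a part seeing only `(S, M)`):
`W2SymOfK K N S M S₂ M₂ b + W2SymOfK K N S′ M′ S₂′ M₂′ b = W2SymOfK K N S′ M′ S₂ M₂ b + W2SymOfK K N S M S₂′ M₂′ b`. -/
theorem W2SymOfK_firstOrder_swap (K : MKer (d + 1) (Fib d)) (N : ℕ) (S M S' M' : Fin (d + 1) → (Fin (d + 1) → ℤ) → MKer (d + 1) (Fib d)) (S₂ M₂ S₂' M₂' : Fin (d + 1) → (Fin (d + 1) → ℤ) → Fin (d + 1) → (Fin (d + 1) → ℤ) → MKer (d + 1) (Fib d))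
    (μ : Fin (d + 1)) (y : Fin (d + 1) → ℤ) (ν : Fin (d + 1)) (y' : Fin (d + 1) → ℤ) :
    W2SymOfK K N S M S₂ M₂ μ y ν y' + W2SymOfK K N S' M' S₂' M₂' μ y ν y' =
      W2SymOfK K N S' M' S₂ M₂ μ y ν y' + W2SymOfK K N S M S₂' M₂' μ y ν y' := by
  simp only [SecondOrderResponse.W2SymOfK, W2OfK_apply, smul_add]
  abel

/-- [folklore] The `K·X·K` sandwich of a negated kernel: `K ∘ (−X) ∘ K = −(K ∘ X ∘ K)` (`KernelReflection.comp_smul_right ∕ comp_smul_left` at `−1`). -/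
theorem sandwich_neg (K X : MKer (d + 1) (Fib d)) : comp (comp K (-X)) K = -comp (comp K X) K := by
  rw [← neg_one_smul ℝ X, KernelReflection.comp_smul_right, KernelReflection.comp_smul_left, neg_one_smul]

/-- [folklore] Entrywise bound of a `LocStencil₂` table by a larger constant. -/
private theorem abs_le_of_locStencil₂' {S₂ : Fin (d + 1) → (Fin (d + 1) → ℤ) → Fin (d + 1) → (Fin (d + 1) → ℤ) → MKer (d + 1) (Fib d)}
    {C δ : ℝ} (h : LocStencil₂ S₂ C δ) (hδ : 0 ≤ δ) {B : ℝ} (hB : C ≤ B)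
    (κ : Fin (d + 1)) (u : Fin (d + 1) → ℤ) (κ' : Fin (d + 1)) (u' x z : Fin (d + 1) → ℤ) (a b : Fib d) :
    |S₂ κ u κ' u' x z a b| ≤ B :=
  (abs_le_of_locStencil₂ h hδ κ u κ' u' x z a b).trans hB

/-- [folklore] **THE ASSEMBLED CARRIERS SWAP THEIR COLOUR TRIPLE WHEN THE BI-STENCIL TABLES DO** (one level, generic data): for a decaying `K`, four bounded bi-stencil tables with
`T₁ + T₂ = T₃ + T₄`, two first-order data `(S,M)`, `(S′,M′)` and two mixed tables `M₂`, `M₂′`,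
`W2SymOfK K N S M T₁ M₂ + W2SymOfK K N S′ M′ T₂ M₂′ = W2SymOfK K N S′ M′ T₃ M₂ + W2SymOfK K N S M T₄ M₂′` (§1 + `W2SymOfK_eq_add_vsym` + `vsym_add`). -/
theorem W2SymOfK_colourSwap_of_tables {K : MKer (d + 1) (Fib d)} {CK δK : ℝ} (hK : Decays K CK δK) (hδK : 0 < δK) (N : ℕ)
    (S M S' M' : Fin (d + 1) → (Fin (d + 1) → ℤ) → MKer (d + 1) (Fib d)) (M₂ M₂' : Fin (d + 1) → (Fin (d + 1) → ℤ) → Fin (d + 1) → (Fin (d + 1) → ℤ) → MKer (d + 1) (Fib d)) {T₁ T₂ T₃ T₄ : Fin (d + 1) → (Fin (d + 1) → ℤ) → Fin (d + 1) → (Fin (d + 1) → ℤ) → MKer (d + 1) (Fib d)} {Bd : ℝ}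
    (h₁ : ∀ κ u κ' u' x z a b, |T₁ κ u κ' u' x z a b| ≤ Bd) (h₂ : ∀ κ u κ' u' x z a b, |T₂ κ u κ' u' x z a b| ≤ Bd)
    (h₃ : ∀ κ u κ' u' x z a b, |T₃ κ u κ' u' x z a b| ≤ Bd) (h₄ : ∀ κ u κ' u' x z a b, |T₄ κ u κ' u' x z a b| ≤ Bd)
    (hT : T₁ + T₂ = T₃ + T₄) :
    W2SymOfK K N S M T₁ M₂ + W2SymOfK K N S' M' T₂ M₂' = W2SymOfK K N S' M' T₃ M₂ + W2SymOfK K N S M T₄ M₂' := by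
  have hv : vsym K N T₁ + vsym K N T₂ = vsym K N T₃ + vsym K N T₄ := by
    funext μ y ν y'
    simp only [Pi.add_apply]
    rw [← vsym_add hK hδK N h₁ h₂, ← vsym_add hK hδK N h₃ h₄, hT]
  rw [W2SymOfK_eq_add_vsym K N S M T₁ M₂, W2SymOfK_eq_add_vsym K N S' M' T₂ M₂', W2SymOfK_eq_add_vsym K N S' M' T₃ M₂,
    W2SymOfK_eq_add_vsym K N S M T₄ M₂']
  funext μ y ν y' x z a b
  have hvp := congrArg (fun F => F μ y ν y' x z a b) hv
  have hsw := congrArg (fun F => F x z a b) (W2SymOfK_firstOrder_swap K N S M S' M' 0 M₂ 0 M₂' μ y ν y')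
  simp only [Pi.add_apply] at hvp hsw ⊢
  linear_combination hvp + hsw

/-! ## §2 The COLOUR SWAP identity for an2's recursive bi-stencil family -/

/-- [folklore] **THE FIRST-ORDER COLOUR TRIPLE CAN BE SWAPPED BETWEEN ANY TWO MEMBERS OF an2's RECURSIVE FAMILY** (`1 ≤ Lc`, any `cE₂`, TWO arbitrary certified border ∕ mixed table
pairs `(B, mixFF)`, `(B′, mixFF′)`, two border weights, two position tables, two colour triples `c⃗ = (cE,cVH,cΛ)`, `c⃗′`, every level `j`):
`T2Of c⃗ cE₂ cB T B mixFF j + T2Of c⃗′ cE₂ cB′ T′ B′ mixFF′ j = T2Of c⃗′ cE₂ cB T B mixFF j + T2Of c⃗ cE₂ cB′ T′ B′ mixFF′ j`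
— member `0` carries no colour constant; member `j+1`: the border summands and the `W`-free parts of the third-order read-outs appear once on each side, and the sandwiches
`K·W·K` of the four assembled carriers balance by `W2SymOfK_colourSwap_of_tables` at level `j` (induction hypothesis) through gan24's `K3OfK_eq_sub_of_W` (common rate from
`decays_KInvStep` and `vertexFamily₂_WbalOf'`), `sandwich_neg` and `mmRead_sub`. -/
theorem T2Of_colourSwap (hLc : 1 ≤ Lc) (cE cVH cΛ cE' cVH' cΛ' cE₂ cB cB' : ℝ) (T T' : Fin 4 → Fin 4 → Fin 4 → Fin 4 → ℝ)
    {B : Fin (d + 1) → (Fin (d + 1) → ℤ) → Fin (d + 1) → (Fin (d + 1) → ℤ) → MKer (d + 1) (Fib d)} (hB : ∃ C δ : ℝ, 0 < δ ∧ LocStencil₂ B C δ)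
    {mixFF : Fin (d + 1) → (Fin (d + 1) → ℤ) → Fin (d + 1) → (Fin (d + 1) → ℤ) → MKer (d + 1) (Fib d)} (hmix : ∃ C δ : ℝ, 0 < δ ∧ LocStencilFM Lc mixFF C δ)
    {B' : Fin (d + 1) → (Fin (d + 1) → ℤ) → Fin (d + 1) → (Fin (d + 1) → ℤ) → MKer (d + 1) (Fib d)} (hB' : ∃ C δ : ℝ, 0 < δ ∧ LocStencil₂ B' C δ)
    {mixFF' : Fin (d + 1) → (Fin (d + 1) → ℤ) → Fin (d + 1) → (Fin (d + 1) → ℤ) → MKer (d + 1) (Fib d)} (hmix' : ∃ C δ : ℝ, 0 < δ ∧ LocStencilFM Lc mixFF' C δ) :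
    ∀ j : ℕ, T2Of d Lc cE cVH cΛ cE₂ cB T B mixFF j + T2Of d Lc cE' cVH' cΛ' cE₂ cB' T' B' mixFF' j =
      T2Of d Lc cE' cVH' cΛ' cE₂ cB T B mixFF j + T2Of d Lc cE cVH cΛ cE₂ cB' T' B' mixFF' j
  | 0 => by
    simp only [T2Of_zero]
  | j + 1 => by
    have IH := T2Of_colourSwap hLc cE cVH cΛ cE' cVH' cΛ' cE₂ cB cB' T T' hB hmix hB' hmix' j
    obtain ⟨C1, δ1, hδ1, hL1⟩ := T2Of_loc (d := d) hLc cE cVH cΛ cE₂ cB T hB hmix j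
    obtain ⟨C2, δ2, hδ2, hL2⟩ := T2Of_loc (d := d) hLc cE' cVH' cΛ' cE₂ cB' T' hB' hmix' j
    obtain ⟨C3, δ3, hδ3, hL3⟩ := T2Of_loc (d := d) hLc cE' cVH' cΛ' cE₂ cB T hB hmix j
    obtain ⟨C4, δ4, hδ4, hL4⟩ := T2Of_loc (d := d) hLc cE cVH cΛ cE₂ cB' T' hB' hmix' j
    obtain ⟨δK, CK, hδK, hCK, hK⟩ := decays_KInvStep (Lc := Lc) (d := d) j
    have hC1 : 0 ≤ C1 := (abs_nonneg _).trans (abs_le_of_locStencil₂ hL1 hδ1.le 0 0 0 0 0 0 (Sum.inl 0) (Sum.inl 0))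
    have hC2 : 0 ≤ C2 := (abs_nonneg _).trans (abs_le_of_locStencil₂ hL2 hδ2.le 0 0 0 0 0 0 (Sum.inl 0) (Sum.inl 0))
    have hC3 : 0 ≤ C3 := (abs_nonneg _).trans (abs_le_of_locStencil₂ hL3 hδ3.le 0 0 0 0 0 0 (Sum.inl 0) (Sum.inl 0))
    have hC4 : 0 ≤ C4 := (abs_nonneg _).trans (abs_le_of_locStencil₂ hL4 hδ4.le 0 0 0 0 0 0 (Sum.inl 0) (Sum.inl 0))
    have hb1 : ∀ κ u κ' u' x z a b, |T2Of d Lc cE cVH cΛ cE₂ cB T B mixFF j κ u κ' u' x z a b| ≤ C1 + C2 + C3 + C4 :=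
      fun κ u κ' u' x z a b => abs_le_of_locStencil₂' hL1 hδ1.le (by linarith) κ u κ' u' x z a b
    have hb2 : ∀ κ u κ' u' x z a b, |T2Of d Lc cE' cVH' cΛ' cE₂ cB' T' B' mixFF' j κ u κ' u' x z a b| ≤ C1 + C2 + C3 + C4 :=
      fun κ u κ' u' x z a b => abs_le_of_locStencil₂' hL2 hδ2.le (by linarith) κ u κ' u' x z a b
    have hb3 : ∀ κ u κ' u' x z a b, |T2Of d Lc cE' cVH' cΛ' cE₂ cB T B mixFF j κ u κ' u' x z a b| ≤ C1 + C2 + C3 + C4 :=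
      fun κ u κ' u' x z a b => abs_le_of_locStencil₂' hL3 hδ3.le (by linarith) κ u κ' u' x z a b
    have hb4 : ∀ κ u κ' u' x z a b, |T2Of d Lc cE cVH cΛ cE₂ cB' T' B' mixFF' j κ u κ' u' x z a b| ≤ C1 + C2 + C3 + C4 :=
      fun κ u κ' u' x z a b => abs_le_of_locStencil₂' hL4 hδ4.le (by linarith) κ u κ' u' x z a b
    have hW : WbalOf d Lc cE cVH cΛ (T2Of d Lc cE cVH cΛ cE₂ cB T B mixFF) mixFF j +
        WbalOf d Lc cE' cVH' cΛ' (T2Of d Lc cE' cVH' cΛ' cE₂ cB' T' B' mixFF') mixFF' j =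
        WbalOf d Lc cE' cVH' cΛ' (T2Of d Lc cE' cVH' cΛ' cE₂ cB T B mixFF) mixFF j +
          WbalOf d Lc cE cVH cΛ (T2Of d Lc cE cVH cΛ cE₂ cB' T' B' mixFF') mixFF' j := by
      unfold BalabanStepW2.WbalOf
      exact W2SymOfK_colourSwap_of_tables hK hδK Lc _ _ _ _ _ _ hb1 hb2 hb3 hb4 IH
    obtain ⟨Cw1, δw1, hδw1, hW1⟩ := vertexFamily₂_WbalOf' (d := d) hLc cE cVH cΛ (T2Of_loc (d := d) hLc cE cVH cΛ cE₂ cB T hB hmix) hmix j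
    obtain ⟨Cw2, δw2, hδw2, hW2⟩ := vertexFamily₂_WbalOf' (d := d) hLc cE' cVH' cΛ' (T2Of_loc (d := d) hLc cE' cVH' cΛ' cE₂ cB' T' hB' hmix') hmix' j
    obtain ⟨Cw3, δw3, hδw3, hW3⟩ := vertexFamily₂_WbalOf' (d := d) hLc cE' cVH' cΛ' (T2Of_loc (d := d) hLc cE' cVH' cΛ' cE₂ cB T hB hmix) hmix j
    obtain ⟨Cw4, δw4, hδw4, hW4⟩ := vertexFamily₂_WbalOf' (d := d) hLc cE cVH cΛ (T2Of_loc (d := d) hLc cE cVH cΛ cE₂ cB' T' hB' hmix') hmix' j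
    set m : ℝ := min δK (min (min δw1 δw2) (min δw3 δw4)) with hm
    have hm0 : 0 < m := lt_min hδK (lt_min (lt_min hδw1 hδw2) (lt_min hδw3 hδw4))
    have hKm : Decays (KInvStep (d := d) Lc j) CK m := decays_mono hK hCK le_rfl (min_le_left _ _)
    have hCw1 : 0 ≤ Cw1 := (hW1 0 0 0 0).nonneg (Sum.inl 0)
    have hCw2 : 0 ≤ Cw2 := (hW2 0 0 0 0).nonneg (Sum.inl 0)
    have hCw3 : 0 ≤ Cw3 := (hW3 0 0 0 0).nonneg (Sum.inl 0)
    have hCw4 : 0 ≤ Cw4 := (hW4 0 0 0 0).nonneg (Sum.inl 0)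
    funext κ u κ' u' x z a b
    have hl1 : BiLoc (WbalOf d Lc cE cVH cΛ (T2Of d Lc cE cVH cΛ cE₂ cB T B mixFF) mixFF j κ u κ' u') ((Lc : ℤ) • u) ((Lc : ℤ) • u') Cw1 m :=
      biLoc_mono (hW1 κ u κ' u') hCw1 ((min_le_right _ _).trans ((min_le_left _ _).trans (min_le_left _ _)))
    have hl2 : BiLoc (WbalOf d Lc cE' cVH' cΛ' (T2Of d Lc cE' cVH' cΛ' cE₂ cB' T' B' mixFF') mixFF' j κ u κ' u') ((Lc : ℤ) • u) ((Lc : ℤ) • u') Cw2 m :=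
      biLoc_mono (hW2 κ u κ' u') hCw2 ((min_le_right _ _).trans ((min_le_left _ _).trans (min_le_right _ _)))
    have hl3 : BiLoc (WbalOf d Lc cE' cVH' cΛ' (T2Of d Lc cE' cVH' cΛ' cE₂ cB T B mixFF) mixFF j κ u κ' u') ((Lc : ℤ) • u) ((Lc : ℤ) • u') Cw3 m :=
      biLoc_mono (hW3 κ u κ' u') hCw3 ((min_le_right _ _).trans ((min_le_right _ _).trans (min_le_left _ _)))
    have hl4 : BiLoc (WbalOf d Lc cE cVH cΛ (T2Of d Lc cE cVH cΛ cE₂ cB' T' B' mixFF') mixFF' j κ u κ' u') ((Lc : ℤ) • u) ((Lc : ℤ) • u') Cw4 m :=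
      biLoc_mono (hW4 κ u κ' u') hCw4 ((min_le_right _ _).trans ((min_le_right _ _).trans (min_le_right _ _)))
    -- the two third-order read-outs with colour `c⃗`, and the two with colour `c⃗′`, differ by sandwiches of opposite kernels
    have h14 := K3OfK_eq_sub_of_W hKm hm0 Lc (Spure d Lc cE cVH cΛ j) (M1 d Lc cΛ j) hl1 hl4
    have h23 := K3OfK_eq_sub_of_W hKm hm0 Lc (Spure d Lc cE' cVH' cΛ' j) (M1 d Lc cΛ' j) hl2 hl3
    have hWp := congrArg (fun F => F κ u κ' u') hW; simp only [Pi.add_apply] at hWp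
    have hopp : WbalOf d Lc cE' cVH' cΛ' (T2Of d Lc cE' cVH' cΛ' cE₂ cB' T' B' mixFF') mixFF' j κ u κ' u' -
        WbalOf d Lc cE' cVH' cΛ' (T2Of d Lc cE' cVH' cΛ' cE₂ cB T B mixFF) mixFF j κ u κ' u' =
        -(WbalOf d Lc cE cVH cΛ (T2Of d Lc cE cVH cΛ cE₂ cB T B mixFF) mixFF j κ u κ' u' -
          WbalOf d Lc cE cVH cΛ (T2Of d Lc cE cVH cΛ cE₂ cB' T' B' mixFF') mixFF' j κ u κ' u') := by
      linear_combination hWp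
    rw [hopp, sandwich_neg] at h23
    have he : e4OfW d Lc j (Spure d Lc cE cVH cΛ j) (M1 d Lc cΛ j) (WbalOf d Lc cE cVH cΛ (T2Of d Lc cE cVH cΛ cE₂ cB T B mixFF) mixFF j) κ u κ' u' +
        e4OfW d Lc j (Spure d Lc cE' cVH' cΛ' j) (M1 d Lc cΛ' j) (WbalOf d Lc cE' cVH' cΛ' (T2Of d Lc cE' cVH' cΛ' cE₂ cB' T' B' mixFF') mixFF' j) κ u κ' u' =
        e4OfW d Lc j (Spure d Lc cE' cVH' cΛ' j) (M1 d Lc cΛ' j) (WbalOf d Lc cE' cVH' cΛ' (T2Of d Lc cE' cVH' cΛ' cE₂ cB T B mixFF) mixFF j) κ u κ' u' +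
          e4OfW d Lc j (Spure d Lc cE cVH cΛ j) (M1 d Lc cΛ j) (WbalOf d Lc cE cVH cΛ (T2Of d Lc cE cVH cΛ cE₂ cB' T' B' mixFF') mixFF' j) κ u κ' u' := by
      unfold BalabanStepW2.e4OfW
      rw [h14, h23, mmRead_sub, mmRead_sub]
      funext x' z' a' b'
      simp only [Pi.sub_apply, Pi.add_apply]
      have hmm : ∀ (F : MKer (d + 1) (Fib d)), mmRead Lc (-F) x' z' a' b' = -mmRead Lc F x' z' a' b' := by
        intro F
        rcases a' with α | m <;> rcases b' with β | m' <;> simp [BalabanStepJetsSucc.mmRead]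
      rw [hmm]
      ring
    have hep := congrArg (fun F => F x z a b) he; simp only [Pi.add_apply] at hep
    simp only [T2Of_succ, Pi.add_apply, Pi.smul_apply, smul_eq_mul]
    linear_combination (cE₂ * wV4 d Lc (j + 1)) * hep

/-! ## §3 The assembled second-order family swaps its colour triple -/

/-- [folklore] **THE COLOUR SWAP FOR an2's ASSEMBLED SECOND-ORDER FAMILY** (same data as §2, every level): the four carriers `WbalOf c⃗ (T2Of …) mixFF j` swap their colour
triple — `W2SymOfK_colourSwap_of_tables` at the level-`j` identity of §2. -/
theorem WbalOf_T2Of_colourSwap (hLc : 1 ≤ Lc) (cE cVH cΛ cE' cVH' cΛ' cE₂ cB cB' : ℝ) (T T' : Fin 4 → Fin 4 → Fin 4 → Fin 4 → ℝ)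
    {B : Fin (d + 1) → (Fin (d + 1) → ℤ) → Fin (d + 1) → (Fin (d + 1) → ℤ) → MKer (d + 1) (Fib d)} (hB : ∃ C δ : ℝ, 0 < δ ∧ LocStencil₂ B C δ)
    {mixFF : Fin (d + 1) → (Fin (d + 1) → ℤ) → Fin (d + 1) → (Fin (d + 1) → ℤ) → MKer (d + 1) (Fib d)} (hmix : ∃ C δ : ℝ, 0 < δ ∧ LocStencilFM Lc mixFF C δ)
    {B' : Fin (d + 1) → (Fin (d + 1) → ℤ) → Fin (d + 1) → (Fin (d + 1) → ℤ) → MKer (d + 1) (Fib d)} (hB' : ∃ C δ : ℝ, 0 < δ ∧ LocStencil₂ B' C δ)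
    {mixFF' : Fin (d + 1) → (Fin (d + 1) → ℤ) → Fin (d + 1) → (Fin (d + 1) → ℤ) → MKer (d + 1) (Fib d)} (hmix' : ∃ C δ : ℝ, 0 < δ ∧ LocStencilFM Lc mixFF' C δ) (j : ℕ) :
    WbalOf d Lc cE cVH cΛ (T2Of d Lc cE cVH cΛ cE₂ cB T B mixFF) mixFF j +
        WbalOf d Lc cE' cVH' cΛ' (T2Of d Lc cE' cVH' cΛ' cE₂ cB' T' B' mixFF') mixFF' j =
      WbalOf d Lc cE' cVH' cΛ' (T2Of d Lc cE' cVH' cΛ' cE₂ cB T B mixFF) mixFF j +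
        WbalOf d Lc cE cVH cΛ (T2Of d Lc cE cVH cΛ cE₂ cB' T' B' mixFF') mixFF' j := by
  obtain ⟨C1, δ1, hδ1, hL1⟩ := T2Of_loc (d := d) hLc cE cVH cΛ cE₂ cB T hB hmix j
  obtain ⟨C2, δ2, hδ2, hL2⟩ := T2Of_loc (d := d) hLc cE' cVH' cΛ' cE₂ cB' T' hB' hmix' j
  obtain ⟨C3, δ3, hδ3, hL3⟩ := T2Of_loc (d := d) hLc cE' cVH' cΛ' cE₂ cB T hB hmix j
  obtain ⟨C4, δ4, hδ4, hL4⟩ := T2Of_loc (d := d) hLc cE cVH cΛ cE₂ cB' T' hB' hmix' j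
  obtain ⟨δK, CK, hδK, -, hK⟩ := decays_KInvStep (Lc := Lc) (d := d) j
  have hC1 : 0 ≤ C1 := (abs_nonneg _).trans (abs_le_of_locStencil₂ hL1 hδ1.le 0 0 0 0 0 0 (Sum.inl 0) (Sum.inl 0))
  have hC2 : 0 ≤ C2 := (abs_nonneg _).trans (abs_le_of_locStencil₂ hL2 hδ2.le 0 0 0 0 0 0 (Sum.inl 0) (Sum.inl 0))
  have hC3 : 0 ≤ C3 := (abs_nonneg _).trans (abs_le_of_locStencil₂ hL3 hδ3.le 0 0 0 0 0 0 (Sum.inl 0) (Sum.inl 0))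
  have hC4 : 0 ≤ C4 := (abs_nonneg _).trans (abs_le_of_locStencil₂ hL4 hδ4.le 0 0 0 0 0 0 (Sum.inl 0) (Sum.inl 0))
  have hb1 : ∀ κ u κ' u' x z a b, |T2Of d Lc cE cVH cΛ cE₂ cB T B mixFF j κ u κ' u' x z a b| ≤ C1 + C2 + C3 + C4 :=
    fun κ u κ' u' x z a b => abs_le_of_locStencil₂' hL1 hδ1.le (by linarith) κ u κ' u' x z a b
  have hb2 : ∀ κ u κ' u' x z a b, |T2Of d Lc cE' cVH' cΛ' cE₂ cB' T' B' mixFF' j κ u κ' u' x z a b| ≤ C1 + C2 + C3 + C4 :=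
    fun κ u κ' u' x z a b => abs_le_of_locStencil₂' hL2 hδ2.le (by linarith) κ u κ' u' x z a b
  have hb3 : ∀ κ u κ' u' x z a b, |T2Of d Lc cE' cVH' cΛ' cE₂ cB T B mixFF j κ u κ' u' x z a b| ≤ C1 + C2 + C3 + C4 :=
    fun κ u κ' u' x z a b => abs_le_of_locStencil₂' hL3 hδ3.le (by linarith) κ u κ' u' x z a b
  have hb4 : ∀ κ u κ' u' x z a b, |T2Of d Lc cE cVH cΛ cE₂ cB' T' B' mixFF' j κ u κ' u' x z a b| ≤ C1 + C2 + C3 + C4 :=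
    fun κ u κ' u' x z a b => abs_le_of_locStencil₂' hL4 hδ4.le (by linarith) κ u κ' u' x z a b
  unfold BalabanStepW2.WbalOf
  exact W2SymOfK_colourSwap_of_tables hK hδK Lc _ _ _ _ _ _ hb1 hb2 hb3 hb4
    (T2Of_colourSwap hLc cE cVH cΛ cE' cVH' cΛ' cE₂ cB cB' T T' hB hmix hB' hmix' j)

/-! ## §4 At `d = 3`: the pinned literal's step kernels and (1.22) coefficients swap their colour triple (two roots) -/

section Kernel

variable {D : ℕ} {F : Type*} [Fintype F]

/-- [folklore] **`hessKer` UNDER THE COLOUR SWAP** (spread leg `A`; bond-pair members localised): if `W₁ b + W₂ b = W₃ b + W₄ b` at the bond pair read, then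
`hessKer A V W₁ + hessKer A V′ W₂ = hessKer A V′ W₃ + hessKer A V W₄` there — the tadpole is additive (`tadpole_add`), and each bubble family travels with its colour triple:
`V` sits with `W₁, W₄`, `V′` with `W₂, W₃`. -/
theorem hessKer_colourSwap {A : MKer D F} (hA : Spr A) (V V' : Fin D → (Fin D → ℤ) → MKer D F)
    {W₁ W₂ W₃ W₄ : Fin D → (Fin D → ℤ) → Fin D → (Fin D → ℤ) → MKer D F} (μ ν : Fin D) (z : Fin D → ℤ)
    (h₁ : Loc (W₁ μ 0 ν z)) (h₂ : Loc (W₂ μ 0 ν z)) (h₃ : Loc (W₃ μ 0 ν z)) (h₄ : Loc (W₄ μ 0 ν z))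
    (hsum : W₁ μ 0 ν z + W₂ μ 0 ν z = W₃ μ 0 ν z + W₄ μ 0 ν z) :
    hessKer A V W₁ μ ν z + hessKer A V' W₂ μ ν z = hessKer A V' W₃ μ ν z + hessKer A V W₄ μ ν z := by
  have ht : tadpole A (W₁ μ 0 ν z) + tadpole A (W₂ μ 0 ν z) = tadpole A (W₃ μ 0 ν z) + tadpole A (W₄ μ 0 ν z) := by rw [← tadpole_add hA h₁ h₂, ← tadpole_add hA h₃ h₄, hsum]
  simp only [ExpKernelCalculus.hessKer]
  linear_combination (1 / 2 : ℝ) * ht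

end Kernel

section Pinned

variable {Lc : ℕ} [NeZero Lc] {r r' : Fin (3 + 1) → ℕ}

/-- [folklore] The first-order part of an2's jet datum does not depend on the second-order tables or their certificates (PRIVATE twin of GEN 9's
`D1PinnedBorderWeightAffine.JsBal0Of_S_indep`; `rfl` by cases). -/
private theorem JsBal0Of_S_indep' (hLc : 1 ≤ Lc) (cE cVH cΛ : ℝ)
    (W W' : ℕ → Fin (3 + 1) → (Fin (3 + 1) → ℤ) → Fin (3 + 1) → (Fin (3 + 1) → ℤ) → MKer (3 + 1) (Fib 3))
    (Cw δw : ℕ → ℝ) (hδw : ∀ j, 0 < δw j) (hW : ∀ j, VertexFamily₂ (W j) Lc (Cw j) (δw j))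
    (Cw' δw' : ℕ → ℝ) (hδw' : ∀ j, 0 < δw' j) (hW' : ∀ j, VertexFamily₂ (W' j) Lc (Cw' j) (δw' j)) :
    ∀ j : ℕ, (JsBal0Of hLc cE cVH cΛ W Cw δw hδw hW j).S = (JsBal0Of hLc cE cVH cΛ W' Cw' δw' hδw' hW' j).S
  | 0 => rfl
  | _ + 1 => rfl

/-- [folklore] **THE COLOUR SWAP FOR THE PINNED FAMILY's STEP KERNELS** (two box roots `r, r′`, two border weights, two tables, any `cE₂`, every level, every entry):
`TbalOf (JsBalAn1 r c⃗ cB T) j b + TbalOf (JsBalAn1 r′ c⃗′ cB′ T′) j b = TbalOf (JsBalAn1 r c⃗′ cB T) j b + TbalOf (JsBalAn1 r′ c⃗ cB′ T′) j b`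
— `TbalOf_JsBalAn1` ×4; the first-order vertex families depend on the colour triple only (not on root, border weight or tables) and travel with it; `axDressK Lc (KInvStep Lc j)`
is universal; §3 at an1's two certificate pairs; `hessKer_colourSwap`. -/
theorem TbalOf_JsBalAn1_colourSwap (hLc : 1 ≤ Lc) (hr : r ∈ box (3 + 1) Lc) (hr' : r' ∈ box (3 + 1) Lc)
    (cE cVH cΛ cE' cVH' cΛ' cE₂ cB cB' : ℝ) (T T' : Fin 4 → Fin 4 → Fin 4 → Fin 4 → ℝ) (j : ℕ) (μ ν : Fin 4) (z : Fin 4 → ℤ) :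
    TbalOf Lc (JsBalAn1 hLc hr cE cVH cΛ cE₂ cB T) j μ ν z + TbalOf Lc (JsBalAn1 hLc hr' cE' cVH' cΛ' cE₂ cB' T') j μ ν z =
      TbalOf Lc (JsBalAn1 hLc hr cE' cVH' cΛ' cE₂ cB T) j μ ν z + TbalOf Lc (JsBalAn1 hLc hr' cE cVH cΛ cE₂ cB' T') j μ ν z := by
  rw [TbalOf_JsBalAn1 hLc hr cE cVH cΛ cE₂ cB T j, TbalOf_JsBalAn1 hLc hr' cE' cVH' cΛ' cE₂ cB' T' j, TbalOf_JsBalAn1 hLc hr cE' cVH' cΛ' cE₂ cB T j,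
    TbalOf_JsBalAn1 hLc hr' cE cVH cΛ cE₂ cB' T' j]
  rw [JsBal0Of_S_indep' hLc cE cVH cΛ (WbalT2Of (Lc := Lc) cE cVH cΛ cE₂ cB T (vh₂S := vh₂SAt (toSite r) Lc) (mixFF := mixFFAt (toSite r) Lc))
      (WbalT2Of (Lc := Lc) cE cVH cΛ cE₂ cB' T' (vh₂S := vh₂SAt (toSite r') Lc) (mixFF := mixFFAt (toSite r') Lc)) _ _ _ _ _ _ _ _ j,
    JsBal0Of_S_indep' hLc cE' cVH' cΛ' (WbalT2Of (Lc := Lc) cE' cVH' cΛ' cE₂ cB' T' (vh₂S := vh₂SAt (toSite r') Lc) (mixFF := mixFFAt (toSite r') Lc))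
      (WbalT2Of (Lc := Lc) cE' cVH' cΛ' cE₂ cB T (vh₂S := vh₂SAt (toSite r) Lc) (mixFF := mixFFAt (toSite r) Lc)) _ _ _ _ _ _ _ _ j]
  have hW : WbalT2Of (Lc := Lc) cE cVH cΛ cE₂ cB T (vh₂S := vh₂SAt (toSite r) Lc) (mixFF := mixFFAt (toSite r) Lc) j +
      WbalT2Of (Lc := Lc) cE' cVH' cΛ' cE₂ cB' T' (vh₂S := vh₂SAt (toSite r') Lc) (mixFF := mixFFAt (toSite r') Lc) j =
      WbalT2Of (Lc := Lc) cE' cVH' cΛ' cE₂ cB T (vh₂S := vh₂SAt (toSite r) Lc) (mixFF := mixFFAt (toSite r) Lc) j +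
        WbalT2Of (Lc := Lc) cE cVH cΛ cE₂ cB' T' (vh₂S := vh₂SAt (toSite r') Lc) (mixFF := mixFFAt (toSite r') Lc) j :=
    WbalOf_T2Of_colourSwap hLc cE cVH cΛ cE' cVH' cΛ' cE₂ cB cB' T T' (hB_an1 hLc hr) (hmix_an1 hLc hr) (hB_an1 hLc hr') (hmix_an1 hLc hr') j
  obtain ⟨δK, CK, hδK, -, hK⟩ := decays_KInvStep (Lc := Lc) (d := 3) j
  have hA : Spr (axDressK Lc (KInvStep (d := 3) Lc j)) := ⟨_, δK, hδK, decays_axDressK hLc hK hδK.le⟩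
  obtain ⟨Cw1, δw1, hδw1, hW1⟩ := vertexFamily₂_WbalOf' (d := 3) hLc cE cVH cΛ
    (T2Of_loc (d := 3) hLc cE cVH cΛ cE₂ cB T (hB_an1 hLc hr) (hmix_an1 hLc hr)) (hmix_an1 hLc hr) j
  obtain ⟨Cw2, δw2, hδw2, hW2⟩ := vertexFamily₂_WbalOf' (d := 3) hLc cE' cVH' cΛ'
    (T2Of_loc (d := 3) hLc cE' cVH' cΛ' cE₂ cB' T' (hB_an1 hLc hr') (hmix_an1 hLc hr')) (hmix_an1 hLc hr') j
  obtain ⟨Cw3, δw3, hδw3, hW3⟩ := vertexFamily₂_WbalOf' (d := 3) hLc cE' cVH' cΛ'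
    (T2Of_loc (d := 3) hLc cE' cVH' cΛ' cE₂ cB T (hB_an1 hLc hr) (hmix_an1 hLc hr)) (hmix_an1 hLc hr) j
  obtain ⟨Cw4, δw4, hδw4, hW4⟩ := vertexFamily₂_WbalOf' (d := 3) hLc cE cVH cΛ
    (T2Of_loc (d := 3) hLc cE cVH cΛ cE₂ cB' T' (hB_an1 hLc hr') (hmix_an1 hLc hr')) (hmix_an1 hLc hr') j
  have hsum := congrArg (fun F => F μ 0 ν z) hW; simp only [Pi.add_apply] at hsum
  exact hessKer_colourSwap hA _ _ μ ν z ⟨_, _, _, _, hδw1, hW1 μ 0 ν z⟩ ⟨_, _, _, _, hδw2, hW2 μ 0 ν z⟩ ⟨_, _, _, _, hδw3, hW3 μ 0 ν z⟩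
    ⟨_, _, _, _, hδw4, hW4 μ 0 ν z⟩ hsum

/-- [folklore] **THE COLOUR SWAP FOR THE PINNED FAMILY's ONE-LOOP STEP COEFFICIENTS** (two roots, two border weights, two tables, any `cE₂`, every level, every channel):
`β⁰_j(r,c⃗;cB,T) + β⁰_j(r′,c⃗′;cB′,T′) = β⁰_j(r,c⃗′;cB,T) + β⁰_j(r′,c⃗;cB′,T′)` (`secondMoment_add` ×2, `hTA_TbalOf`). -/
theorem secondMoment_JsBalAn1_colourSwap (hLc : 1 ≤ Lc) (hr : r ∈ box (3 + 1) Lc) (hr' : r' ∈ box (3 + 1) Lc)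
    (cE cVH cΛ cE' cVH' cΛ' cE₂ cB cB' : ℝ) (T T' : Fin 4 → Fin 4 → Fin 4 → Fin 4 → ℝ) (j : ℕ) (μ ν : Fin 4) :
    B12Beta.secondMoment (TbalOf Lc (JsBalAn1 hLc hr cE cVH cΛ cE₂ cB T) j) μ ν +
        B12Beta.secondMoment (TbalOf Lc (JsBalAn1 hLc hr' cE' cVH' cΛ' cE₂ cB' T') j) μ ν =
      B12Beta.secondMoment (TbalOf Lc (JsBalAn1 hLc hr cE' cVH' cΛ' cE₂ cB T) j) μ ν +
        B12Beta.secondMoment (TbalOf Lc (JsBalAn1 hLc hr' cE cVH cΛ cE₂ cB' T') j) μ ν := by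
  have hker : TbalOf Lc (JsBalAn1 hLc hr cE cVH cΛ cE₂ cB T) j + TbalOf Lc (JsBalAn1 hLc hr' cE' cVH' cΛ' cE₂ cB' T') j =
      TbalOf Lc (JsBalAn1 hLc hr cE' cVH' cΛ' cE₂ cB T) j + TbalOf Lc (JsBalAn1 hLc hr' cE cVH cΛ cE₂ cB' T') j := by
    funext μ' ν' z
    simp only [Pi.add_apply]
    exact TbalOf_JsBalAn1_colourSwap hLc hr hr' cE cVH cΛ cE' cVH' cΛ' cE₂ cB cB' T T' j μ' ν' z
  rw [← secondMoment_add (hTA_TbalOf (JsBalAn1 hLc hr cE cVH cΛ cE₂ cB T) j) (hTA_TbalOf (JsBalAn1 hLc hr' cE' cVH' cΛ' cE₂ cB' T') j),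
    ← secondMoment_add (hTA_TbalOf (JsBalAn1 hLc hr cE' cVH' cΛ' cE₂ cB T) j) (hTA_TbalOf (JsBalAn1 hLc hr' cE cVH cΛ cE₂ cB' T') j), hker]

end Pinned

/-! ## §5 UNCONDITIONAL at the pin `cE₂ := Lc^8`, `2 ≤ Lc`: the colour response of the limit is universal -/

section Consequences

variable {Lc : ℕ} [NeZero Lc] {r r' : Fin (3 + 1) → ℕ}

/-- [folklore] **THE COLOUR SWAP FOR THE LIMIT, HYPOTHESIS-FREE** (four-member form; two roots, two border weights, two tables):
`lim β⁰(r,c⃗;cB,Tc) + lim β⁰(r′,c⃗′;cB′,Tc′) = lim β⁰(r,c⃗′;cB,Tc) + lim β⁰(r′,c⃗;cB′,Tc′)` (§4 at every level + `tendsto_pinned` ×4 + `tendsto_nhds_unique`). -/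
theorem lim_JsBalAn1_colourSwap (hLc : 2 ≤ Lc) (hr : r ∈ box (3 + 1) Lc) (hr' : r' ∈ box (3 + 1) Lc) (cE cVH cΛ cE' cVH' cΛ' cB cB' : ℝ)
    (Tc Tc' : Fin 4 → Fin 4 → Fin 4 → Fin 4 → ℝ) (μ ν : Fin 4) :
    CauchyRate.lim (fun j => B12Beta.secondMoment (TbalOf Lc (JsBalAn1 (one_le_of_two_le hLc) hr cE cVH cΛ ((Lc : ℝ) ^ (2 * (3 + 1))) cB Tc) j) μ ν) +
        CauchyRate.lim (fun j => B12Beta.secondMoment (TbalOf Lc (JsBalAn1 (one_le_of_two_le hLc) hr' cE' cVH' cΛ' ((Lc : ℝ) ^ (2 * (3 + 1))) cB' Tc') j) μ ν) =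
      CauchyRate.lim (fun j => B12Beta.secondMoment (TbalOf Lc (JsBalAn1 (one_le_of_two_le hLc) hr cE' cVH' cΛ' ((Lc : ℝ) ^ (2 * (3 + 1))) cB Tc) j) μ ν) +
        CauchyRate.lim (fun j => B12Beta.secondMoment (TbalOf Lc (JsBalAn1 (one_le_of_two_le hLc) hr' cE cVH cΛ ((Lc : ℝ) ^ (2 * (3 + 1))) cB' Tc') j) μ ν) := by
  have h1 := tendsto_pinned hLc hr cE cVH cΛ cB Tc μ ν
  have h2 := tendsto_pinned hLc hr' cE' cVH' cΛ' cB' Tc' μ ν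
  have h3 := tendsto_pinned hLc hr cE' cVH' cΛ' cB Tc μ ν
  have h4 := tendsto_pinned hLc hr' cE cVH cΛ cB' Tc' μ ν
  exact tendsto_nhds_unique (h1.add h2) ((h3.add h4).congr fun j =>
    (secondMoment_JsBalAn1_colourSwap (one_le_of_two_le hLc) hr hr' cE cVH cΛ cE' cVH' cΛ' _ cB cB' Tc Tc' j μ ν).symm)

/-! ## §6 Readings -/

/-- [folklore] **THE COLOUR RESPONSE OF `lim β⁰` IS FREE OF THE ROOT, THE BORDER WEIGHT AND THE POSITION TABLE**:
`lim β⁰(r,c⃗;cB,Tc) − lim β⁰(r,c⃗′;cB,Tc) = lim β⁰(r′,c⃗;cB′,Tc′) − lim β⁰(r′,c⃗′;cB′,Tc′)` (hypothesis-free) — the response of the limit to a change of the first-order colour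
triple is ONE function of the two triples (and `Lc`, `(μ,ν)`). -/
theorem colourResponse_universal (hLc : 2 ≤ Lc) (hr : r ∈ box (3 + 1) Lc) (hr' : r' ∈ box (3 + 1) Lc) (cE cVH cΛ cE' cVH' cΛ' cB cB' : ℝ)
    (Tc Tc' : Fin 4 → Fin 4 → Fin 4 → Fin 4 → ℝ) (μ ν : Fin 4) :
    CauchyRate.lim (fun j => B12Beta.secondMoment (TbalOf Lc (JsBalAn1 (one_le_of_two_le hLc) hr cE cVH cΛ ((Lc : ℝ) ^ (2 * (3 + 1))) cB Tc) j) μ ν) -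
        CauchyRate.lim (fun j => B12Beta.secondMoment (TbalOf Lc (JsBalAn1 (one_le_of_two_le hLc) hr cE' cVH' cΛ' ((Lc : ℝ) ^ (2 * (3 + 1))) cB Tc) j) μ ν) =
      CauchyRate.lim (fun j => B12Beta.secondMoment (TbalOf Lc (JsBalAn1 (one_le_of_two_le hLc) hr' cE cVH cΛ ((Lc : ℝ) ^ (2 * (3 + 1))) cB' Tc') j) μ ν) -
        CauchyRate.lim (fun j => B12Beta.secondMoment (TbalOf Lc (JsBalAn1 (one_le_of_two_le hLc) hr' cE' cVH' cΛ' ((Lc : ℝ) ^ (2 * (3 + 1))) cB' Tc') j) μ ν) := by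
  linear_combination lim_JsBalAn1_colourSwap hLc hr hr' cE cVH cΛ cE' cVH' cΛ' cB cB' Tc Tc' μ ν

/-- [folklore] **ROOT PART PLUS COLOUR PART, HYPOTHESIS-FREE**: for ANY reference root `r₀`,
`lim β⁰(r,c⃗;cB,Tc) = lim β⁰(r,0⃗;cB,Tc) + (lim β⁰(r₀,c⃗;0,0) − lim β⁰(r₀,0⃗;0,0))`, `0⃗ = (0,0,0)` — ALL dependence on the first-order colour triple sits in ONE root-free,
border-free, table-free correction read at the reference member `(r₀; ·; 0, 0)`; the rest is the colour-free value `lim β⁰(r,0⃗;cB,Tc)` (by the sibling files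
`= γ(r) + cB·σ(r) + λ(Tc)` up to the normalisation of `γ`). -/
theorem lim_eq_rootPart_add_colourPart (hLc : 2 ≤ Lc) (hr : r ∈ box (3 + 1) Lc) (hr₀ : r' ∈ box (3 + 1) Lc) (cE cVH cΛ cB : ℝ)
    (Tc : Fin 4 → Fin 4 → Fin 4 → Fin 4 → ℝ) (μ ν : Fin 4) :
    CauchyRate.lim (fun j => B12Beta.secondMoment (TbalOf Lc (JsBalAn1 (one_le_of_two_le hLc) hr cE cVH cΛ ((Lc : ℝ) ^ (2 * (3 + 1))) cB Tc) j) μ ν) =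
      CauchyRate.lim (fun j => B12Beta.secondMoment (TbalOf Lc (JsBalAn1 (one_le_of_two_le hLc) hr 0 0 0 ((Lc : ℝ) ^ (2 * (3 + 1))) cB Tc) j) μ ν) +
        (CauchyRate.lim (fun j => B12Beta.secondMoment (TbalOf Lc (JsBalAn1 (one_le_of_two_le hLc) hr₀ cE cVH cΛ ((Lc : ℝ) ^ (2 * (3 + 1))) 0 0) j) μ ν) - CauchyRate.lim (fun j => B12Beta.secondMoment (TbalOf Lc (JsBalAn1 (one_le_of_two_le hLc) hr₀ 0 0 0 ((Lc : ℝ) ^ (2 * (3 + 1))) 0 0) j) μ ν)) := by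
  linear_combination lim_JsBalAn1_colourSwap hLc hr hr₀ cE cVH cΛ 0 0 0 cB 0 Tc 0 μ ν

/-- [folklore] **(D1) AT THE PINNED LITERAL WITH THE COLOUR DEPENDENCE SEPARATED FROM THE ROOT AND THE SECOND-ORDER DATA, HYPOTHESIS-FREE**: for every numeral `N`,
`D1Drift Lc (JsBalAn1 r c⃗ … cB Tc) N μ ν ↔ lim β⁰(r,0⃗;cB,Tc) + (lim β⁰(r₀,c⃗;0,0) − lim β⁰(r₀,0⃗;0,0)) = stepBal N Lc` (g1-p3's `d1Drift_pinned_iff_lim_eq` + the previous theorem). -/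
theorem d1Drift_JsBalAn1_iff_colourSeparated (hLc : 2 ≤ Lc) (hr : r ∈ box (3 + 1) Lc) (hr₀ : r' ∈ box (3 + 1) Lc) (cE cVH cΛ cB : ℝ)
    (Tc : Fin 4 → Fin 4 → Fin 4 → Fin 4 → ℝ) (μ ν : Fin 4) (N : ℝ) :
    D1Drift Lc (JsBalAn1 (one_le_of_two_le hLc) hr cE cVH cΛ ((Lc : ℝ) ^ (2 * (3 + 1))) cB Tc) N μ ν ↔
      CauchyRate.lim (fun j => B12Beta.secondMoment (TbalOf Lc (JsBalAn1 (one_le_of_two_le hLc) hr 0 0 0 ((Lc : ℝ) ^ (2 * (3 + 1))) cB Tc) j) μ ν) +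
          (CauchyRate.lim (fun j => B12Beta.secondMoment (TbalOf Lc (JsBalAn1 (one_le_of_two_le hLc) hr₀ cE cVH cΛ ((Lc : ℝ) ^ (2 * (3 + 1))) 0 0) j) μ ν) - CauchyRate.lim (fun j => B12Beta.secondMoment (TbalOf Lc (JsBalAn1 (one_le_of_two_le hLc) hr₀ 0 0 0 ((Lc : ℝ) ^ (2 * (3 + 1))) 0 0) j) μ ν)) =
        B12Normalization.stepBal N Lc := by
  rw [d1Drift_pinned_iff_lim_eq hLc hr cE cVH cΛ cB Tc μ ν N, lim_eq_rootPart_add_colourPart hLc hr hr₀ cE cVH cΛ cB Tc μ ν]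

/-- [folklore] **COLOUR-BLIND AT ONE MEMBER IS COLOUR-BLIND AT EVERY MEMBER, HYPOTHESIS-FREE**: if at ONE root, border weight and table the limit takes the same value at two
colour triples, it does so at every root, border weight and table. -/
theorem colourBlind_everywhere_of_somewhere (hLc : 2 ≤ Lc) (hr₀ : r' ∈ box (3 + 1) Lc) (cB₀ : ℝ) (Tc₀ : Fin 4 → Fin 4 → Fin 4 → Fin 4 → ℝ)
    (cE cVH cΛ cE' cVH' cΛ' : ℝ) (μ ν : Fin 4)
    (hblind : CauchyRate.lim (fun j => B12Beta.secondMoment (TbalOf Lc (JsBalAn1 (one_le_of_two_le hLc) hr₀ cE cVH cΛ ((Lc : ℝ) ^ (2 * (3 + 1))) cB₀ Tc₀) j) μ ν) = CauchyRate.lim (fun j => B12Beta.secondMoment (TbalOf Lc (JsBalAn1 (one_le_of_two_le hLc) hr₀ cE' cVH' cΛ' ((Lc : ℝ) ^ (2 * (3 + 1))) cB₀ Tc₀) j) μ ν))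
    (hr : r ∈ box (3 + 1) Lc) (cB : ℝ) (Tc : Fin 4 → Fin 4 → Fin 4 → Fin 4 → ℝ) :
    CauchyRate.lim (fun j => B12Beta.secondMoment (TbalOf Lc (JsBalAn1 (one_le_of_two_le hLc) hr cE cVH cΛ ((Lc : ℝ) ^ (2 * (3 + 1))) cB Tc) j) μ ν) = CauchyRate.lim (fun j => B12Beta.secondMoment (TbalOf Lc (JsBalAn1 (one_le_of_two_le hLc) hr cE' cVH' cΛ' ((Lc : ℝ) ^ (2 * (3 + 1))) cB Tc) j) μ ν) := by
  linear_combination lim_JsBalAn1_colourSwap hLc hr hr₀ cE cVH cΛ cE' cVH' cΛ' cB cB₀ Tc Tc₀ μ ν + hblind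

end Consequences

end Summit.QuantumFields.BalabanUV.Gaps.D1PinnedColourResponseUniversal

end
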